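import Mathlib
import Summits.Ventures.PercRepro2.K5Kernel
import Summits.Ventures.PercRepro2.K5Kron
import Summits.Ventures.PercRepro2.K5Digits
import Summits.Ventures.PercRepro2.K5Theorem
import Summits.Ventures.PercRepro2.PMK5Kernel
import Summits.Ventures.PercRepro2.PMK5Strict
import Summits.Ventures.PercRepro2.PMK5Locus
import Summits.Ventures.PercRepro2.PMK5KernelY
import Summits.Ventures.PercRepro2.PMTypedTri

/-!
# THE `a₂`-SIDE SAME-SIDE HARRIS SLACK `SS′ = P·B − oH·bH` ON `K₅`: certificate and equality locus, positive side
(blind cell PercRepro2, mine-2 g24; the mirror of `PMK5LocusSS.lean` (`SS = P·A − oL·bL`) for Theorem 22′ — the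
equality locus of (HCOV) on `K₅ + a₃ pendant at the root a₁`, through `HCovSwap.Gc_swap`)

`SS′ = P(Q) P(Q, oH, bH) − P(Q, oH) P(Q, bH) ≥ 0` (Harris on `C₂`); as a degree-3 Bernstein form (third table all-true):
two products, **`certSSb`**, the bridge **`ssb_eq_bern`**.  Census (own code, two methods, 1,024 / 1,024): `SS′ ≡ 0` on
the face of `S` for 480 edge sets, EXACTLY **`RuleSSb`** = ¬[o ~ b avoiding {a₁, a₂}] ∨ ¬[o ~ a₂ avoiding {a₁}] (the
mirror of `RuleSS`); seven minimal supports ({oa₂ ob}, {ou ob a₂u}, {ob a₂b}, {oa₂ ou ub}, {ou a₂u ub}, {ob a₂u ub},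
{ou a₂b ub}), four maximal faces 249, 503, 637, 1011; 96,120 positive profiles, maximum 1,420.  Standard axioms.
-/

namespace Summit.Ventures.PercRepro2

open Hub CovForm

namespace K5

namespace PM

/-- The positive part of `SS′`: `P·B`. -/
def kPosSSb : ℕ := kron tQ * kron tQHoBH * kron tOne

/-- The negative part of `SS′`: `oH·bH`. -/
def kNegSSb : ℕ := kron tQHo * kron tQB * kron tOne

set_option maxRecDepth 100000 in
set_option maxHeartbeats 0 in
/-- **The `K₅` certificate of the `a₂`-side same-side slack**: `kPosSSb ≥ kNegSSb` digitwise. -/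
theorem certSSb : kNegSSb ≤ kPosSSb ∧ Nat.land (kPosSSb - kNegSSb) mask = 0 ∧ Nat.land kNegSSb mask = 0 := by
  decide +kernel

/-- The positive triple counts of `SS′`. -/
def cntPosSSb (k : Fin 10 → Fin 4) : ℕ := cnt3 tQ tQHoBH tOne k

/-- The negative triple counts of `SS′`. -/
def cntNegSSb (k : Fin 10 → Fin 4) : ℕ := cnt3 tQHo tQB tOne k

/-- `kPosSSb` carries the positive counts. -/
lemma kPosSSb_eq : kPosSSb = ∑ k, cntPosSSb k * KB ^ idx4 k := by
  unfold kPosSSb cntPosSSb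
  rw [kron_eq_kronSum tQ, kron_eq_kronSum tQHoBH, kron_eq_kronSum tOne, kronSum_mul_mul]

/-- `kNegSSb` carries the negative counts. -/
lemma kNegSSb_eq : kNegSSb = ∑ k, cntNegSSb k * KB ^ idx4 k := by
  unfold kNegSSb cntNegSSb
  rw [kron_eq_kronSum tQHo, kron_eq_kronSum tQB, kron_eq_kronSum tOne, kronSum_mul_mul]

/-- The counts are bounded by `3^10 < 2^19`. -/
lemma cntPosSSb_lt (k : Fin 10 → Fin 4) : cntPosSSb k < 2 ^ 19 := by
  unfold cntPosSSb
  have := cnt3_le tQ tQHoBH tOne k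
  omega

/-- The counts are bounded by `3^10 < 2^19`. -/
lemma cntNegSSb_lt (k : Fin 10 → Fin 4) : cntNegSSb k < 2 ^ 19 := by
  unfold cntNegSSb
  have := cnt3_le tQHo tQB tOne k
  omega

/-- **Every Bernstein coefficient of `SS′` on `K₅` is `≥ 0`** (from `certSSb`). -/
theorem cntNegSSb_le_cntPosSSb (k : Fin 10 → Fin 4) : cntNegSSb k ≤ cntPosSSb k :=
  le_of_kron_le cntPosSSb cntNegSSb cntPosSSb_lt cntNegSSb_lt kPosSSb_eq kNegSSb_eq certSSb.1 certSSb.2.1 k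

section Bernstein

variable {R : Type*} [Field R] [LinearOrder R] [IsStrictOrderedRing R]

omit [LinearOrder R] [IsStrictOrderedRing R] in
/-- **The `a₂`-side same-side slack on `K₅` in the degree-3 Bernstein basis.** -/
theorem ssb_eq_bern (p : Fin 10 → R) :
    prob p (avoidAll ends5 2 {1}) * prob p (avoidAll ends5 2 {1} ∩ (connEvent ends5 2 0 ∩ connEvent ends5 2 4)) -
        prob p (avoidAll ends5 2 {1} ∩ connEvent ends5 2 0) * prob p (avoidAll ends5 2 {1} ∩ connEvent ends5 2 4) =
      ∑ k, bern p k * ((cntPosSSb k : ℕ) - (cntNegSSb k : ℕ) : R) := by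
  rw [prob_eq_bform p _ _ tQ_iff, prob_eq_bform p _ _ tQHoBH_iff, prob_eq_bform p _ _ Pendant.tQHo_iff',
    prob_eq_bform p _ _ tQB_iff]
  have e : ∀ P B oH bH one : R, one = 1 → P * B - oH * bH = P * B * one - oH * bH * one := by
    intros; subst_vars; ring
  rw [e _ _ _ _ (bform p (indR tOne)) (one_eq_bform p).symm, bform_mul_mul, bform_mul_mul,
    ← Finset.sum_sub_distrib]
  refine Finset.sum_congr rfl fun k _ => ?_
  rw [coef3_eq_cnt3, coef3_eq_cnt3]
  unfold cntPosSSb cntNegSSb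
  ring

end Bernstein

set_option maxRecDepth 100000 in
/-- The class sums of `SS′` at the 7 witness profiles, read off the Kronecker digits of `kPosSSb − kNegSSb`. -/
theorem digSSb : (kPosSSb - kNegSSb) / KB ^ 132 % KB = 2 ∧
    (kPosSSb - kNegSSb) / KB ^ 32928 % KB = 6 ∧
    (kPosSSb - kNegSSb) / KB ^ 65664 % KB = 2 ∧
    (kPosSSb - kNegSSb) / KB ^ 524324 % KB = 4 ∧
    (kPosSSb - kNegSSb) / KB ^ 540704 % KB = 4 ∧
    (kPosSSb - kNegSSb) / KB ^ 557184 % KB = 6 ∧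
    (kPosSSb - kNegSSb) / KB ^ 589856 % KB = 4 := by
  decide +kernel

/-- Witness 0: the profile of index `132` (support `{oa2 ob}`, mask `10`) has the `SS′`-class sum `2`. -/
theorem wSSb0 : cntNegSSb (decode4 132) < cntPosSSb (decode4 132) :=
  digit_lt_of_kron cntPosSSb cntNegSSb cntPosSSb_lt cntNegSSb_le_cntPosSSb kPosSSb_eq kNegSSb_eq 132
    (by norm_num) digSSb.1 (by norm_num)
/-- Witness 1: the profile of index `32928` (support `{ou ob a2u}`, mask `140`) has the `SS′`-class sum `6`. -/
theorem wSSb1 : cntNegSSb (decode4 32928) < cntPosSSb (decode4 32928) :=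
  digit_lt_of_kron cntPosSSb cntNegSSb cntPosSSb_lt cntNegSSb_le_cntPosSSb kPosSSb_eq kNegSSb_eq 32928
    (by norm_num) digSSb.2.1 (by norm_num)
/-- Witness 2: the profile of index `65664` (support `{ob a2b}`, mask `264`) has the `SS′`-class sum `2`. -/
theorem wSSb2 : cntNegSSb (decode4 65664) < cntPosSSb (decode4 65664) :=
  digit_lt_of_kron cntPosSSb cntNegSSb cntPosSSb_lt cntNegSSb_le_cntPosSSb kPosSSb_eq kNegSSb_eq 65664
    (by norm_num) digSSb.2.2.1 (by norm_num)
/-- Witness 3: the profile of index `524324` (support `{oa2 ou ub}`, mask `518`) has the `SS′`-class sum `4`. -/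
theorem wSSb3 : cntNegSSb (decode4 524324) < cntPosSSb (decode4 524324) :=
  digit_lt_of_kron cntPosSSb cntNegSSb cntPosSSb_lt cntNegSSb_le_cntPosSSb kPosSSb_eq kNegSSb_eq 524324
    (by norm_num) digSSb.2.2.2.1 (by norm_num)
/-- Witness 4: the profile of index `540704` (support `{ou a2u ub}`, mask `644`) has the `SS′`-class sum `4`. -/
theorem wSSb4 : cntNegSSb (decode4 540704) < cntPosSSb (decode4 540704) :=
  digit_lt_of_kron cntPosSSb cntNegSSb cntPosSSb_lt cntNegSSb_le_cntPosSSb kPosSSb_eq kNegSSb_eq 540704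
    (by norm_num) digSSb.2.2.2.2.1 (by norm_num)
/-- Witness 5: the profile of index `557184` (support `{ob a2u ub}`, mask `648`) has the `SS′`-class sum `6`. -/
theorem wSSb5 : cntNegSSb (decode4 557184) < cntPosSSb (decode4 557184) :=
  digit_lt_of_kron cntPosSSb cntNegSSb cntPosSSb_lt cntNegSSb_le_cntPosSSb kPosSSb_eq kNegSSb_eq 557184
    (by norm_num) digSSb.2.2.2.2.2.1 (by norm_num)
/-- Witness 6: the profile of index `589856` (support `{ou a2b ub}`, mask `772`) has the `SS′`-class sum `4`. -/
theorem wSSb6 : cntNegSSb (decode4 589856) < cntPosSSb (decode4 589856) :=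
  digit_lt_of_kron cntPosSSb cntNegSSb cntPosSSb_lt cntNegSSb_le_cntPosSSb kPosSSb_eq kNegSSb_eq 589856
    (by norm_num) digSSb.2.2.2.2.2.2 (by norm_num)

/-- The Kronecker indices of the 7 witness profiles. -/
def NSSb : Fin 7 → ℕ := ![132, 32928, 65664, 524324, 540704, 557184, 589856]

/-- The supports of the 7 witness profiles, as edge bitmasks. -/
def WSSb : Fin 7 → ℕ := ![10, 140, 264, 518, 644, 648, 772]

/-- Every witness coefficient of `SS′` is strictly positive. -/
theorem witnessSSb_lt : ∀ i : Fin 7, cntNegSSb (decode4 (NSSb i)) < cntPosSSb (decode4 (NSSb i)) := by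
  intro i
  fin_cases i
  exacts [wSSb0, wSSb1, wSSb2, wSSb3, wSSb4, wSSb5, wSSb6]

set_option maxRecDepth 100000 in
/-- The support of the `i`-th witness profile is the mask `WSSb i`. -/
theorem supp_WSSb : ∀ i : Fin 7, ∀ e : Fin 10, decode4 (NSSb i) e ≠ 0 → (WSSb i).testBit e = true := by
  decide +kernel

/-- **The `SS′`-degenerate edge sets**: the root pair separates `o` from `b`, or `a₂` cannot reach `o` avoiding `a₁`. -/
def RuleSSb (m : ℕ) : Bool :=
  (!conn (cfgAvoid2 m 1 2) 0 4) || (!conn (cfgAvoid m 1) 0 2)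

set_option maxRecDepth 100000 in
/-- **The covering**: every non-`SS′`-degenerate edge set contains the support of a witness profile. -/
theorem coverSSb : ∀ m : Fin 1024, RuleSSb m = false →
    ∃ i : Fin 7, ∀ e : Fin 10, (WSSb i).testBit e = true → (m : ℕ).testBit e = true := by
  decide +kernel

section Face

variable {R : Type*} [Field R] [LinearOrder R] [IsStrictOrderedRing R]

/-- **THE EQUALITY LOCUS OF `SS′` — THE POSITIVE SIDE (Bernstein form).** -/
theorem ssb_K5_pos_of_face (m : ℕ) (hm : m < 1024) (hr : RuleSSb m = false) (q : Fin 10 → R)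
    (hq₁ : ∀ e : Fin 10, m.testBit e = true → 0 < q e ∧ q e < 1)
    (hq₀ : ∀ e : Fin 10, m.testBit e = false → q e = 0) :
    0 < ∑ k, bern q k * ((cntPosSSb k : ℕ) - (cntNegSSb k : ℕ) : R) := by
  obtain ⟨i, hi⟩ := coverSSb ⟨m, hm⟩ hr
  have hk := witnessSSb_lt i
  have hs : ∀ e : Fin 10, decode4 (NSSb i) e ≠ 0 → m.testBit e = true := fun e he => hi e (supp_WSSb i e he)
  have hb : 0 < bern q (decode4 (NSSb i)) := bern_pos_of_face hq₁ hq₀ _ hs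
  have h01 : ∀ e, 0 ≤ q e ∧ q e ≤ 1 := fun e => by
    by_cases he : m.testBit e = true
    · exact ⟨(hq₁ e he).1.le, (hq₁ e he).2.le⟩
    · rw [hq₀ e (by simpa using he)]
      exact ⟨le_rfl, zero_le_one⟩
  calc (0 : R) < bern q (decode4 (NSSb i)) * ((cntPosSSb (decode4 (NSSb i)) : ℕ) - (cntNegSSb (decode4 (NSSb i)) : ℕ) : R) := by
        apply mul_pos hb
        rw [sub_pos]
        exact_mod_cast hk
    _ ≤ ∑ k, bern q k * ((cntPosSSb k : ℕ) - (cntNegSSb k : ℕ) : R) :=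
        Finset.single_le_sum (f := fun k => bern q k * ((cntPosSSb k : ℕ) - (cntNegSSb k : ℕ) : R))
          (fun k _ => mul_nonneg (bern_nonneg h01 k) (by rw [sub_nonneg]; exact_mod_cast cntNegSSb_le_cntPosSSb k))
          (Finset.mem_univ _)

end Face

end PM

end K5

end Summit.Ventures.PercRepro2
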